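import Mathlib
import HarnessLib
import Summits.NavierStokesRegularity.NavierStokesRegularity.Theses.PoloidalWindowDoor
import Summits.NavierStokesRegularity.NavierStokesRegularity.Theorems.PoloidalWindowDoorPoloidalWindowRigiditySharper
import Summits.NavierStokesRegularity.NavierStokesRegularity.Theorems.PoloidalWindowDoorPoloidalWindowRigidityK2OfLrcSpatial
import Summits.NavierStokesRegularity.NavierStokesRegularity.Theorems.PoloidalWindowDoorPoloidalWindowRigidityHorizontalFlatPast
import Summits.NavierStokesRegularity.NavierStokesRegularity.Theorems.PoloidalWindowDoorPoloidalWindowRigidityTimeShearLiminf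
import Summits.NavierStokesRegularity.NavierStokesRegularity.Theorems.PoloidalWindowDoorPoloidalWindowRigidityStubUntwisted
import Summits.NavierStokesRegularity.NavierStokesRegularity.Theorems.PoloidalWindowDoorPoloidalWindowRigidityThmAThreeStubs
import Summits.NavierStokesRegularity.NavierStokesRegularity.Theorems.PoloidalWindowDoorPoloidalWindowRigidityThmARelocation


/-!
# Line `riesz_collapse` — crux `PoloidalWindowRigidity` (K2, stmt-NavierStokesRegularity-19708), SEMI-ELLIPTIC THICK column (cell `hST`):
# a SEMI-ELLIPTIC SLICE of a Type-I ancient mild profile is RIGID — the Riesz mass of its superharmonic pressure is `O(R^{α−2}) → 0` by the class ENERGY LEVEL,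
# so `−Δp = |∇_h v_h|² + (∂₂v₂)² + 2I ≡ 0` on the slice; the twist clause of `hST` is then violated: the cell is EMPTY modulo one M-sized lemma

IDEATOR seat ns-idea-8 (generation g4), lens «barrier» (the precisely-typed statement just outside the killed classes): the N0 THICK column of
LADDER-NS, cell `hST` of `…ThmAThreeStubs.twisting_regular_of_three` (twisting THICK windows inside a SEMI-ELLIPTIC slab, `I := ∂₂v₀∂₀v₂ + ∂₂v₁∂₁v₂ ≥ 0`
on `(a,b) × ℝ³`).  Registered attacks on this cell: `mixed_type` (DGNM / `A₂` / convexity-in-height), `strain_tube` (g3: superharmonic pressure + (F1) ⇒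
SLICE-WISE Morrey FLOOR `∫_{B_R}(−Δp)(s) ≤ K R/(−s)`; S1 landed p637042 `…StrainGrowth`), `sparse_energy` (cstrat; scaled energy), and the tree's
`…EllipticSliceThinStrain` (`O(R)` via (F1)), `…Equipartition` (`O(R²)`, sup bounds).  All of them bound the Riesz mass of the superharmonic slice pressure
through `∫|p − c|` ((F1): `O(R³/(−s))`) or through sup bounds — and stop at the scale-invariant FLOOR `R¹` (STRATEGY-CENSUS T14; strain_tube card «the floor»).

THE LEVER (one line, new on this crux): do NOT pass through `p`.  For a divergence-free `C²` slice, `−Δp = tr((Dv)²) = ∂_i∂_j(v_i v_j)` (pressure Poisson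
identity), so against the smooth cut-off `χ_R` (`= 1` on `B̄_R`, support `B̄_{2R}`, `‖D²χ_R‖ ≤ c/R²` — tree
`…EnstrophyHessianCollar.exists_norm_iteratedFDeriv_two_smoothTransition_cutoff_le`; the same «one more integration by parts into the Hessian collar» move):
    `∫ χ_R (−Δp)(s) = ∫ (v ⊗ v) : D²χ_R ≤ (9c/R²) ∫_{B̄(0,2R)} |v(s)|² ≤ (9c/R²) · K (2R)^α (−s)^{−(α−1)/2} = O(R^{α−2})`
by the whole-class ENERGY LEVEL `…LargeScaleEnergyBootstrapUniform.exists_uniform_level_of_gt_one` (KERNEL: every `α ∈ (1,3]`, every `R > 0`, every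
`t < 0`; take `α = 3/2`).  The floor `R¹` came from `∫_{B_{2R}}|v|² ≤ C R³/(−s)` (sup bound) resp. (F1); the level `α < 2` puts the Riesz mass BELOW `R⁰`:
it TENDS TO ZERO.  On a semi-elliptic slice (`I ≥ 0` everywhere; poloidal, so the horizontal block of `Dv` is symmetric and
`−Δp = e := |∇_h v_h|² + (∂₂v₂)² + 2I ≥ 0` pointwise, `…PressureRegime`) the map `R ↦ ∫_{B_R} e(s)` is non-decreasing, `≥ 0` and `≤ ∫χ_R e(s) → 0`:
    **`e ≡ 0` on every semi-elliptic slice: `∇_h v_h ≡ 0`, `∂₂v₂ ≡ 0`, `I ≡ 0`** — STUB R1 `stub_rieszCollapse` (provable, M-sized; all ingredients in the tree).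
The cell `hST` then closes by CONTRADICTION, kernel-checked here (`semiEllipticThick_of_rieszCollapse`): its window `W` is non-empty, lies in the slab, and carries
the twist clause `∂₀(∂₂v₂)·∂₁v₂ − ∂₁(∂₂v₂)·∂₀v₂ ≠ 0`, impossible when `∂₂v₂ ≡ 0` on the slice.  No Liouville theorem, no frozen law, no (TH)/THICK distinction is
used: SEMI-ELLIPTIC SLICES DO NOT TWIST.  (Sign-symmetric: a slice with `−Δp ≤ 0` everywhere has `e ≡ 0` too; only slices on which `|∇v|² − |ω|²` CHANGES SIGN
survive — recorded for the hyperbolic columns, not used.)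

(M) IS CONSUMED, AND WHERE: the energy level rests on the Oseen identity; refuter1's (M)-free semi-elliptic witness K-52 `…Negative.SemiEllipticColumnField.seField`
(`I ≥ (9/16)ρ(x₀)ρ(x₂)`, twisting thick near `0`) is a SHEET with `∫_{B_R}|V|² ≍ R³`, violating the level — `semiEllipticThick_false_without_mild` honoured at R1.
CONSISTENCY: R1 re-proves, as special cases, the closed (TH)-semi-elliptic cell (Theorem A, `…VerticalConvexity`) and the elliptic stratum M11
(`…EllipticSlopeUnconditional`), and strictly supersedes `strain_tube` S1 / `ThinStrain` / `Equipartition` on such slices.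

STUBS: R1 `stub_rieszCollapse` (the lever; M: pressure-free double integration by parts against the Hessian of the cut-off + energy level `α = 3/2` +
monotone-and-vanishing ⇒ zero + continuity) ⊢ `semiEllipticThick_of_rieszCollapse` = the shared `stub_semiEllipticThick` (`hST`) PROVED from R1 ALONE (sorry-free
given R1); shared sorried stubs `stub_hyperbolicTH` ((TH)-hyperbolic column: string_shells / entire_slices) and `stub_hyperbolicThick` (hyperbolic THICK column:
z_shock / mixed_type) VERBATIM; composition `PoloidalWindowRigidity_of_rieszCollapse : …Theses.PoloidalWindowDoor.PoloidalWindowRigidity` kernel-checked (the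
`strain_tube` v2.1 / `mixed_type` v2 chain over `twisting_regular_of_three`, `stub_untwisted`, `nonflatLiouville_of_lrc_spatial`,
`poloidalWindowRigidity_of_sliceSharpNonflatLiouville`).  `lean check`: rc 0, sorries = 3 = stubs (2 shared + 1 own, the own one PROVABLE).  After R1 lands
`--supports 19708`, crux 19708's THICK column is the HYPERBOLIC columns only (`hH`, `hHT`).

NOVELTY vs listed lines/routes: every registered line and tree theorem on this cell bounds the superharmonic pressure's Riesz mass through `|p − c|` + (F1) or
through sup bounds (floor `R¹`); none pairs the pressure Poisson identity `−Δp = ∂_i∂_j(v_iv_j)` with the ENERGY LEVEL `α < 2`, which sends the mass to `0` and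
empties the cell.  BARRIERS: technique_class = pressure Poisson identity + whole-class energy level (large-scale bookkeeping); not a symmetry reduction
(period_door census), not a local jet statement (`local*_false_without_momentum` not triggered: R1 carries the class binders and is (M)-consuming), not DGNM
(no ellipticity constant: `I ≥ 0` enters only as `e ≥ 0`), polynomial sector untouched (Theorem P), no self-similar object (SELFSIM-NOGO), Liouville wall NOT
met (no Liouville theorem is invoked: the contradiction is kinematic once `e ≡ 0`).  INSTRUMENT ROW (would refute R1): a Type-I ancient MILD poloidal profile
with a slice on which `I ≥ 0` everywhere and `(∇_h v_h, ∂₂v₂, I) ≠ 0` somewhere — by the argument above it would violate the kernel theorem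
`exists_uniform_level_of_gt_one`; i.e. R1 can only fail in its FORMALISATION (cut-off Hessian bookkeeping, Fubini/IBP side conditions), which is the cheapest
falsifier: write the three integrations by parts in Lean.  HONESTY: no summit is proved; the crux is NOT proved (two shared hyperbolic stubs remain open); the
cell `hST` is claimed EMPTY modulo the M-sized stub R1, and the claim is exposed to the critic with its complete proof route.  bears_on: LADDER-NS N0 (crux
19708), cell `hST`.
-/

noncomputable section

set_option linter.dupNamespace false
set_option linter.unusedVariables false

namespace Summit.NavierStokesRegularity.NavierStokesRegularity.Cruxes.PoloidalWindowRigidity.RieszCollapse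

open Set Function Metric MeasureTheory
open scoped RealInnerProductSpace InnerProductSpace Topology
open Literature.Analysis Literature.Analysis.FluidPDE
open Summit.NavierStokesRegularity.NavierStokesRegularity.Theorems.PoloidalWindowDoorPoloidalWindowRigiditySharper
open Summit.NavierStokesRegularity.NavierStokesRegularity.Theorems.PoloidalWindowDoorPoloidalWindowRigidityK2OfLrcSpatial
open Summit.NavierStokesRegularity.NavierStokesRegularity.Theorems.PoloidalWindowDoorPoloidalWindowRigidityHorizontalFlatPast
open Summit.NavierStokesRegularity.NavierStokesRegularity.Theorems.PoloidalWindowDoorPoloidalWindowRigidityThmAThreeStubs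
open Summit.NavierStokesRegularity.NavierStokesRegularity.Theorems.PoloidalWindowDoorPoloidalWindowRigidityThmARelocation

/-! ### Shared stubs (other columns; restated VERBATIM so that the composition is self-contained) -/

/-- **STUB (`stub_hyperbolicTH`) — SHARED VERBATIM with `Lines/mixed_type.lean` / `z_shock.lean` (`hH` of `twisting_regular_of_three`): hyperbolic
(TH) twisting windows are regular.**  Lines of record: string_shells (proved there from its own stubs), entire_slices.  Not re-cut here.
Why it might fail: as recorded there (`twistingTH_false_without_mild`: (M) load-bearing). -/
theorem stub_hyperbolicTH :
    ∀ (C : ℝ) (v : ℝ → EuclideanSpace ℝ (Fin 3) → EuclideanSpace ℝ (Fin 3)),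
      Literature.Analysis.FluidPDE.HasTypeITimeDecay C v →
      ContinuousOn (Function.uncurry v) (Set.Iio (0 : ℝ) ×ˢ Set.univ) →
      (∀ s t : ℝ, s < t → t < 0 → ∀ x, v t x =
        Literature.Analysis.UnboundedOperators.heatExtension (v s) (t - s) x -
          Literature.Analysis.FluidPDE.oseenDuhamel 1 s v v t x) →
      (∀ t < 0, Literature.Analysis.FluidPDE.VectorCalculus.IsDivFree (v t)) →
      (∀ s < 0, ∀ y, ⟪Literature.Analysis.FluidPDE.curl (v s) y, EuclideanSpace.single 2 1⟫_ℝ = 0) →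
      ∀ W : Set (ℝ × EuclideanSpace ℝ (Fin 3)), IsOpen W → W.Nonempty → W ⊆ Set.Iio (0 : ℝ) ×ˢ Set.univ →
        (∀ z ∈ W, Literature.Analysis.FluidPDE.curl (v z.1) z.2 ≠ 0 ∧
          (fderiv ℝ (v z.1) z.2 (EuclideanSpace.single 0 1) 2 ≠ 0 ∨ fderiv ℝ (v z.1) z.2 (EuclideanSpace.single 1 1) 2 ≠ 0) ∧
          (fderiv ℝ (v z.1) z.2 (EuclideanSpace.single 2 1) 0 ≠ 0 ∨ fderiv ℝ (v z.1) z.2 (EuclideanSpace.single 2 1) 1 ≠ 0)) →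
        (∀ m : ℝ → ℝ, ∀ W₁ : Set (ℝ × EuclideanSpace ℝ (Fin 3)), W₁ ⊆ W → IsOpen W₁ → W₁.Nonempty →
          ∃ z ∈ W₁, ∃ b : Fin 3, b ≠ 2 ∧
            fderiv ℝ (v z.1) z.2 (EuclideanSpace.single 2 1) b ≠
              m z.1 * fderiv ℝ (v z.1) z.2 (EuclideanSpace.single b 1) 2) →
        (∀ z ∈ W,
          fderiv ℝ (fun x => fderiv ℝ (v z.1) x (EuclideanSpace.single 2 1) 2) z.2 (EuclideanSpace.single 0 1) *
              fderiv ℝ (v z.1) z.2 (EuclideanSpace.single 1 1) 2 -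
            fderiv ℝ (fun x => fderiv ℝ (v z.1) x (EuclideanSpace.single 2 1) 2) z.2 (EuclideanSpace.single 1 1) *
              fderiv ℝ (v z.1) z.2 (EuclideanSpace.single 0 1) 2 ≠ 0) →
        (∀ z ∈ W,
          fderiv ℝ (v z.1) z.2 (EuclideanSpace.single 2 1) 0 * fderiv ℝ (v z.1) z.2 (EuclideanSpace.single 0 1) 2 +
            fderiv ℝ (v z.1) z.2 (EuclideanSpace.single 2 1) 1 * fderiv ℝ (v z.1) z.2 (EuclideanSpace.single 1 1) 2 < 0) →
        (∃ m : ℝ → ℝ → ℝ, ∀ z ∈ W, ∀ b : Fin 3, b ≠ 2 →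
          fderiv ℝ (v z.1) z.2 (EuclideanSpace.single 2 1) b =
            m z.1 (z.2 2) * fderiv ℝ (v z.1) z.2 (EuclideanSpace.single b 1) 2) →
        ¬ Literature.Analysis.FluidPDE.IsBackwardSingularPoint v 0 := by

  sorry

/-- **STUB (`stub_hyperbolicThick`) — SHARED VERBATIM with `Lines/mixed_type.lean` (`hHT` of `twisting_regular_of_three`; z_shock proves it from
its split `stub_zShockThickAut | stub_zShockThickMod | stub_mixedPocketThick`): hyperbolic THICK twisting windows are regular.**  Not re-cut here.
Why it might fail: the THICK wall, hyperbolic side (`hyperbolicThick_false_without_mild`). -/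
theorem stub_hyperbolicThick :
    ∀ (C : ℝ) (v : ℝ → EuclideanSpace ℝ (Fin 3) → EuclideanSpace ℝ (Fin 3)),
      Literature.Analysis.FluidPDE.HasTypeITimeDecay C v →
      ContinuousOn (Function.uncurry v) (Set.Iio (0 : ℝ) ×ˢ Set.univ) →
      (∀ s t : ℝ, s < t → t < 0 → ∀ x, v t x =
        Literature.Analysis.UnboundedOperators.heatExtension (v s) (t - s) x -
          Literature.Analysis.FluidPDE.oseenDuhamel 1 s v v t x) →
      (∀ t < 0, Literature.Analysis.FluidPDE.VectorCalculus.IsDivFree (v t)) →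
      (∀ s < 0, ∀ y, ⟪Literature.Analysis.FluidPDE.curl (v s) y, EuclideanSpace.single 2 1⟫_ℝ = 0) →
      ∀ W : Set (ℝ × EuclideanSpace ℝ (Fin 3)), IsOpen W → W.Nonempty → W ⊆ Set.Iio (0 : ℝ) ×ˢ Set.univ →
        (∀ z ∈ W, Literature.Analysis.FluidPDE.curl (v z.1) z.2 ≠ 0 ∧
          (fderiv ℝ (v z.1) z.2 (EuclideanSpace.single 0 1) 2 ≠ 0 ∨ fderiv ℝ (v z.1) z.2 (EuclideanSpace.single 1 1) 2 ≠ 0) ∧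
          (fderiv ℝ (v z.1) z.2 (EuclideanSpace.single 2 1) 0 ≠ 0 ∨ fderiv ℝ (v z.1) z.2 (EuclideanSpace.single 2 1) 1 ≠ 0)) →
        (∀ m : ℝ → ℝ, ∀ W₁ : Set (ℝ × EuclideanSpace ℝ (Fin 3)), W₁ ⊆ W → IsOpen W₁ → W₁.Nonempty →
          ∃ z ∈ W₁, ∃ b : Fin 3, b ≠ 2 ∧
            fderiv ℝ (v z.1) z.2 (EuclideanSpace.single 2 1) b ≠
              m z.1 * fderiv ℝ (v z.1) z.2 (EuclideanSpace.single b 1) 2) →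
        (∀ z ∈ W,
          fderiv ℝ (fun x => fderiv ℝ (v z.1) x (EuclideanSpace.single 2 1) 2) z.2 (EuclideanSpace.single 0 1) *
              fderiv ℝ (v z.1) z.2 (EuclideanSpace.single 1 1) 2 -
            fderiv ℝ (fun x => fderiv ℝ (v z.1) x (EuclideanSpace.single 2 1) 2) z.2 (EuclideanSpace.single 1 1) *
              fderiv ℝ (v z.1) z.2 (EuclideanSpace.single 0 1) 2 ≠ 0) →
        (∀ z ∈ W,
          fderiv ℝ (v z.1) z.2 (EuclideanSpace.single 2 1) 0 * fderiv ℝ (v z.1) z.2 (EuclideanSpace.single 0 1) 2 +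
            fderiv ℝ (v z.1) z.2 (EuclideanSpace.single 2 1) 1 * fderiv ℝ (v z.1) z.2 (EuclideanSpace.single 1 1) 2 < 0) →
        (∀ m : ℝ → ℝ → ℝ, ∀ W₁ : Set (ℝ × EuclideanSpace ℝ (Fin 3)), W₁ ⊆ W → IsOpen W₁ → W₁.Nonempty →
          ∃ z ∈ W₁, ∃ b : Fin 3, b ≠ 2 ∧
            fderiv ℝ (v z.1) z.2 (EuclideanSpace.single 2 1) b ≠
              m z.1 (z.2 2) * fderiv ℝ (v z.1) z.2 (EuclideanSpace.single b 1) 2) →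
        ¬ Literature.Analysis.FluidPDE.IsBackwardSingularPoint v 0 := by

  sorry
/-! ### This line's stub: SEMI-ELLIPTIC SLICES ARE RIGID -/

/-- **STUB R1 (`stub_rieszCollapse`) — THE LEVER, provable (M-sized): on a slice `s < 0` of a class profile, poloidal along `e₃`, with
`I := ∂₂v₀∂₀v₂ + ∂₂v₁∂₁v₂ ≥ 0` EVERYWHERE on the slice, the three non-negative summands of `−Δp = |∇_h v_h|² + (∂₂v₂)² + 2I` vanish identically:
`(∂₀v₀)² + (∂₀v₁)² + (∂₁v₀)² + (∂₁v₁)² = 0`, `∂₂v₂ = 0`, `I = 0` at every point (`∂ⱼvᵢ = Dv(single j 1) i`).**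
PROOF ROUTE (every ingredient is a tree theorem).  (i) The slice is real-analytic (`…TypeIAnalytic` / `…ClassRate`) and divergence-free; poloidality
(`ω₂ = 0 ⇔ ∂₀v₁ = ∂₁v₀`) makes `e := |∇_h v_h|² + (∂₂v₂)² + 2I = Σ_{i,j} ∂ⱼvᵢ ∂ᵢvⱼ = tr((Dv)²)`, and `tr((Dv)²) = ∂ᵢ∂ⱼ(vᵢvⱼ)` for divergence-free `C²` fields
(`∂ᵢ∂ⱼ(vᵢvⱼ) = ∂ⱼvᵢ∂ᵢvⱼ + v·∇(div v)`; entrywise form in the tree: `…Equipartition.divergence_inner_smul_fderiv_apply`, `⟪Dv(Dv b),a⟫ = div(⟪v,a⟫∂_b v)`).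
(ii) With the smooth cut-off `χ_R(y) = smoothTransition(2 − ‖y‖²/R²)` (`= 1` on `B̄_R`, support `B̄_{√2 R} ⊆ B̄_{2R}`, `‖D²χ_R‖ ≤ c/R²`:
`…EnstrophyHessianCollar.exists_norm_iteratedFDeriv_two_smoothTransition_cutoff_le`; gradient/Laplacian companions in `…LargeScaleEnergy`), two integrations by
parts without boundary (`integral_mul_divergence_add_eq_zero_left`, then `…Equipartition.integral_mul_inner_fderiv_fderiv_eq`-style once more):
`∫ χ_R e(s) = ∫ Σ vᵢvⱼ ∂ᵢ∂ⱼχ_R ≤ (9c/R²) ∫_{B̄(0,2R)} ‖v(s)‖²`.  (iii) ENERGY LEVEL `…LargeScaleEnergyBootstrapUniform.exists_uniform_level_of_gt_one` with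
`α = 3/2`: `∫_{B̄(0,2R)}‖v(s)‖² ≤ K (2R)^{3/2} (−s)^{−1/4}`, hence `0 ≤ ∫ χ_R e(s) ≤ 9cK2^{3/2} R^{−1/2} (−s)^{−1/4} → 0` (`R → ∞`).  (iv) `e ≥ 0` on the slice
(squares + the binder `0 ≤ I`), so for `r ≤ R`: `0 ≤ ∫_{B_r} e(s) ≤ ∫ χ_R e(s)`; let `R → ∞`: `∫_{B_r} e(s) = 0` for every `r`, `e(s,·)` continuous and `≥ 0`
⇒ `e ≡ 0` ⇒ each summand `= 0`.  (M) consumed through the level: K-52's (M)-free `seField` is a sheet (`∫_{B_R}|V|² ≍ R³`) and violates the conclusion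
(`I > 0` near `0`) — `semiEllipticThick_false_without_mild` honoured HERE.  The argument is sign-symmetric (`−Δp ≤ 0` everywhere ⇒ `e ≡ 0` as well).
Why it might fail: only the formalisation — Hessian-of-cut-off bookkeeping in `EuclideanSpace ℝ (Fin 3)` coordinates, the integrability side conditions of the
two integrations by parts (compact support, `C²` slice), and `∫_{B_r} e = 0 ∧ e ≥ 0 continuous ⇒ e = 0` (`MeasureTheory.setIntegral_eq_zero_iff_of_nonneg`-type). -/
theorem stub_rieszCollapse :
    ∀ (C : ℝ) (v : ℝ → EuclideanSpace ℝ (Fin 3) → EuclideanSpace ℝ (Fin 3)),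
      Literature.Analysis.FluidPDE.HasTypeITimeDecay C v →
      ContinuousOn (Function.uncurry v) (Set.Iio (0 : ℝ) ×ˢ Set.univ) →
      (∀ s t : ℝ, s < t → t < 0 → ∀ x, v t x =
        Literature.Analysis.UnboundedOperators.heatExtension (v s) (t - s) x -
          Literature.Analysis.FluidPDE.oseenDuhamel 1 s v v t x) →
      (∀ t < 0, Literature.Analysis.FluidPDE.VectorCalculus.IsDivFree (v t)) →
      (∀ s < 0, ∀ y, ⟪Literature.Analysis.FluidPDE.curl (v s) y, EuclideanSpace.single 2 1⟫_ℝ = 0) →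
      ∀ s : ℝ, s < 0 →
        (∀ y : EuclideanSpace ℝ (Fin 3),
          0 ≤ fderiv ℝ (v s) y (EuclideanSpace.single 2 1) 0 * fderiv ℝ (v s) y (EuclideanSpace.single 0 1) 2 +
                fderiv ℝ (v s) y (EuclideanSpace.single 2 1) 1 * fderiv ℝ (v s) y (EuclideanSpace.single 1 1) 2) →
        ∀ y : EuclideanSpace ℝ (Fin 3),
          (fderiv ℝ (v s) y (EuclideanSpace.single 0 1) 0) ^ 2 + (fderiv ℝ (v s) y (EuclideanSpace.single 0 1) 1) ^ 2 +
              (fderiv ℝ (v s) y (EuclideanSpace.single 1 1) 0) ^ 2 + (fderiv ℝ (v s) y (EuclideanSpace.single 1 1) 1) ^ 2 = 0 ∧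
            fderiv ℝ (v s) y (EuclideanSpace.single 2 1) 2 = 0 ∧
            fderiv ℝ (v s) y (EuclideanSpace.single 2 1) 0 * fderiv ℝ (v s) y (EuclideanSpace.single 0 1) 2 +
                fderiv ℝ (v s) y (EuclideanSpace.single 2 1) 1 * fderiv ℝ (v s) y (EuclideanSpace.single 1 1) 2 = 0 := by
  sorry

/-! ### Composition, step 1 (proved): the shared stub `stub_semiEllipticThick` (`hST`) from R1 ALONE — semi-elliptic slices do not twist -/

/-- **`stub_semiEllipticThick` (shared with `mixed_type` / `z_shock` / `far_thread` / `thread_axis` / `strain_tube`, = `hST` of `twisting_regular_of_three`)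
PROVED from R1**: pick a point `z` of the (non-empty) window; its slice `z.1` lies in the semi-elliptic slab, so by R1 `∂₂v₂ ≡ 0` on that slice; then
`x ↦ ∂₂v₂(z.1, x)` is the zero function, its derivative vanishes, and the twist clause `∂₀(∂₂v₂)·∂₁v₂ − ∂₁(∂₂v₂)·∂₀v₂ ≠ 0` at `z` is violated. -/
theorem semiEllipticThick_of_rieszCollapse :
    ∀ (C : ℝ) (v : ℝ → EuclideanSpace ℝ (Fin 3) → EuclideanSpace ℝ (Fin 3)),
      Literature.Analysis.FluidPDE.HasTypeITimeDecay C v →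
      ContinuousOn (Function.uncurry v) (Set.Iio (0 : ℝ) ×ˢ Set.univ) →
      (∀ s t : ℝ, s < t → t < 0 → ∀ x, v t x =
        Literature.Analysis.UnboundedOperators.heatExtension (v s) (t - s) x -
          Literature.Analysis.FluidPDE.oseenDuhamel 1 s v v t x) →
      (∀ t < 0, Literature.Analysis.FluidPDE.VectorCalculus.IsDivFree (v t)) →
      (∀ s < 0, ∀ y, ⟪Literature.Analysis.FluidPDE.curl (v s) y, EuclideanSpace.single 2 1⟫_ℝ = 0) →
      ∀ W : Set (ℝ × EuclideanSpace ℝ (Fin 3)), IsOpen W → W.Nonempty → W ⊆ Set.Iio (0 : ℝ) ×ˢ Set.univ →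
        (∀ z ∈ W, Literature.Analysis.FluidPDE.curl (v z.1) z.2 ≠ 0 ∧
          (fderiv ℝ (v z.1) z.2 (EuclideanSpace.single 0 1) 2 ≠ 0 ∨ fderiv ℝ (v z.1) z.2 (EuclideanSpace.single 1 1) 2 ≠ 0) ∧
          (fderiv ℝ (v z.1) z.2 (EuclideanSpace.single 2 1) 0 ≠ 0 ∨ fderiv ℝ (v z.1) z.2 (EuclideanSpace.single 2 1) 1 ≠ 0)) →
        (∀ m : ℝ → ℝ, ∀ W₁ : Set (ℝ × EuclideanSpace ℝ (Fin 3)), W₁ ⊆ W → IsOpen W₁ → W₁.Nonempty →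
          ∃ z ∈ W₁, ∃ b : Fin 3, b ≠ 2 ∧
            fderiv ℝ (v z.1) z.2 (EuclideanSpace.single 2 1) b ≠
              m z.1 * fderiv ℝ (v z.1) z.2 (EuclideanSpace.single b 1) 2) →
        (∀ z ∈ W,
          fderiv ℝ (fun x => fderiv ℝ (v z.1) x (EuclideanSpace.single 2 1) 2) z.2 (EuclideanSpace.single 0 1) *
              fderiv ℝ (v z.1) z.2 (EuclideanSpace.single 1 1) 2 -
            fderiv ℝ (fun x => fderiv ℝ (v z.1) x (EuclideanSpace.single 2 1) 2) z.2 (EuclideanSpace.single 1 1) *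
              fderiv ℝ (v z.1) z.2 (EuclideanSpace.single 0 1) 2 ≠ 0) →
        ∀ a b : ℝ, W ⊆ Set.Ioo a b ×ˢ Set.univ →
          (∀ s ∈ Set.Ioo a b, ∀ y : EuclideanSpace ℝ (Fin 3),
            0 ≤ fderiv ℝ (v s) y (EuclideanSpace.single 2 1) 0 * fderiv ℝ (v s) y (EuclideanSpace.single 0 1) 2 +
                fderiv ℝ (v s) y (EuclideanSpace.single 2 1) 1 * fderiv ℝ (v s) y (EuclideanSpace.single 1 1) 2) →
          (∀ m : ℝ → ℝ → ℝ, ∀ W₁ : Set (ℝ × EuclideanSpace ℝ (Fin 3)), W₁ ⊆ W → IsOpen W₁ → W₁.Nonempty →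
          ∃ z ∈ W₁, ∃ b : Fin 3, b ≠ 2 ∧
            fderiv ℝ (v z.1) z.2 (EuclideanSpace.single 2 1) b ≠
              m z.1 (z.2 2) * fderiv ℝ (v z.1) z.2 (EuclideanSpace.single b 1) 2) →
          ¬ Literature.Analysis.FluidPDE.IsBackwardSingularPoint v 0 := by
  intro C v hrate hcont hmild hdiv hpol W hW hWne hWs hnd hpin htw a b hWab hsemi hth
  obtain ⟨z, hz⟩ := hWne
  have hz1 : z.1 ∈ Set.Ioo a b := (Set.mem_prod.1 (hWab hz)).1
  have hs0 : z.1 < 0 := by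
    have h := (Set.mem_prod.1 (hWs hz)).1
    simpa using h
  have hsemiz : ∀ y : EuclideanSpace ℝ (Fin 3),
      0 ≤ fderiv ℝ (v z.1) y (EuclideanSpace.single 2 1) 0 * fderiv ℝ (v z.1) y (EuclideanSpace.single 0 1) 2 +
          fderiv ℝ (v z.1) y (EuclideanSpace.single 2 1) 1 * fderiv ℝ (v z.1) y (EuclideanSpace.single 1 1) 2 :=
    fun y => hsemi z.1 hz1 y
  have hR := stub_rieszCollapse C v hrate hcont hmild hdiv hpol z.1 hs0 hsemiz
  have hwz : (fun x => fderiv ℝ (v z.1) x (EuclideanSpace.single 2 1) 2) = fun _ => (0 : ℝ) :=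
    funext fun x => (hR x).2.1
  have hzero : fderiv ℝ (fun x => fderiv ℝ (v z.1) x (EuclideanSpace.single 2 1) 2) z.2 (EuclideanSpace.single 0 1) *
        fderiv ℝ (v z.1) z.2 (EuclideanSpace.single 1 1) 2 -
      fderiv ℝ (fun x => fderiv ℝ (v z.1) x (EuclideanSpace.single 2 1) 2) z.2 (EuclideanSpace.single 1 1) *
        fderiv ℝ (v z.1) z.2 (EuclideanSpace.single 0 1) 2 = 0 := by
    rw [hwz]
    simp
  exact absurd hzero (htw z hz)

/-! ### Composition, step 2 (proved): `stub_twisting`, then the crux (= `mixed_type` v2 / `string_shells` v2 chain) -/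

/-- **NON-DEGENERATE + PIN + TWISTING ⇒ regular** — VERBATIM the statement of the registered stub `stub_twisting` of
`Lines/lrc_jet.lean` v5 (= `mixed_type`'s `twisting_of_mixedType`), PROVED: `hH` from the shared (TH) stub `stub_hyperbolicTH`, `hHT` from the shared stub `stub_hyperbolicThick` (hyperbolic thick column: lines z_shock / mixed_type), `hST` from `semiEllipticThick_of_rieszCollapse` (THIS LINE). -/
theorem twisting_of_rieszCollapse :
    ∀ (C : ℝ) (v : ℝ → EuclideanSpace ℝ (Fin 3) → EuclideanSpace ℝ (Fin 3)),
      Literature.Analysis.FluidPDE.HasTypeITimeDecay C v →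
      ContinuousOn (Function.uncurry v) (Set.Iio (0 : ℝ) ×ˢ Set.univ) →
      (∀ s t : ℝ, s < t → t < 0 → ∀ x, v t x =
        Literature.Analysis.UnboundedOperators.heatExtension (v s) (t - s) x -
          Literature.Analysis.FluidPDE.oseenDuhamel 1 s v v t x) →
      (∀ t < 0, Literature.Analysis.FluidPDE.VectorCalculus.IsDivFree (v t)) →
      (∀ s < 0, ∀ y, ⟪Literature.Analysis.FluidPDE.curl (v s) y, EuclideanSpace.single 2 1⟫_ℝ = 0) →
      ∀ W : Set (ℝ × EuclideanSpace ℝ (Fin 3)), IsOpen W → W.Nonempty → W ⊆ Set.Iio (0 : ℝ) ×ˢ Set.univ →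
        (∀ z ∈ W, Literature.Analysis.FluidPDE.curl (v z.1) z.2 ≠ 0 ∧
          (fderiv ℝ (v z.1) z.2 (EuclideanSpace.single 0 1) 2 ≠ 0 ∨ fderiv ℝ (v z.1) z.2 (EuclideanSpace.single 1 1) 2 ≠ 0) ∧
          (fderiv ℝ (v z.1) z.2 (EuclideanSpace.single 2 1) 0 ≠ 0 ∨ fderiv ℝ (v z.1) z.2 (EuclideanSpace.single 2 1) 1 ≠ 0)) →
        (∀ m : ℝ → ℝ, ∀ W₁ : Set (ℝ × EuclideanSpace ℝ (Fin 3)), W₁ ⊆ W → IsOpen W₁ → W₁.Nonempty →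
          ∃ z ∈ W₁, ∃ b : Fin 3, b ≠ 2 ∧
            fderiv ℝ (v z.1) z.2 (EuclideanSpace.single 2 1) b ≠
              m z.1 * fderiv ℝ (v z.1) z.2 (EuclideanSpace.single b 1) 2) →
        (∀ z ∈ W,
          fderiv ℝ (fun x => fderiv ℝ (v z.1) x (EuclideanSpace.single 2 1) 2) z.2 (EuclideanSpace.single 0 1) *
              fderiv ℝ (v z.1) z.2 (EuclideanSpace.single 1 1) 2 -
            fderiv ℝ (fun x => fderiv ℝ (v z.1) x (EuclideanSpace.single 2 1) 2) z.2 (EuclideanSpace.single 1 1) *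
              fderiv ℝ (v z.1) z.2 (EuclideanSpace.single 0 1) 2 ≠ 0) →
        ¬ Literature.Analysis.FluidPDE.IsBackwardSingularPoint v 0 := by
  intro C v hrate hcont hmild hdiv hpol W hW hWne hWs hnd hpin htw
  refine twisting_regular_of_three C v hrate hcont hmild hdiv ?_ ?_ ?_ W hW hWne hWs hnd hpin htw
  · -- hH : hyperbolic (TH) windows
    intro W' hW' hW'ne hW's hnd' hpin' htw' hhyp' hTH'
    exact stub_hyperbolicTH C v hrate hcont hmild hdiv hpol W' hW' hW'ne hW's hnd' hpin' htw' hhyp' hTH'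
  · -- hHT : hyperbolic thick windows (shared stub; lines z_shock / mixed_type)
    intro W' hW' hW'ne hW's hnd' hpin' htw' hhyp' hth'
    exact stub_hyperbolicThick C v hrate hcont hmild hdiv hpol W' hW' hW'ne hW's hnd' hpin' htw' hhyp' hth'
  · -- hST : twisting thick windows inside a semi-elliptic slab (THIS LINE: S1, S2 → S3)
    intro W' hW' hW'ne hW's hnd' hpin' htw' a b hWab hsemi hth'
    exact semiEllipticThick_of_rieszCollapse C v hrate hcont hmild hdiv hpol W' hW' hW'ne hW's hnd' hpin' htw' a b hWab hsemi hth'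

/-! ### Composition, step 2 (proved, = `mixed_type` v2 / `lrc_jet` v5 chain): the crux -/

/-- **NON-DEGENERATE + PIN ⇒ regular** — the pointwise twist dichotomy over the tree theorem `…StubUntwisted.stub_untwisted`
(p561151, the untwisted half) and `twisting_of_rieszCollapse` (the twisting half). -/
theorem ndRegular :
    ∀ (C : ℝ) (v : ℝ → EuclideanSpace ℝ (Fin 3) → EuclideanSpace ℝ (Fin 3)),
      Literature.Analysis.FluidPDE.HasTypeITimeDecay C v →
      ContinuousOn (Function.uncurry v) (Set.Iio (0 : ℝ) ×ˢ Set.univ) →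
      (∀ s t : ℝ, s < t → t < 0 → ∀ x, v t x =
        Literature.Analysis.UnboundedOperators.heatExtension (v s) (t - s) x -
          Literature.Analysis.FluidPDE.oseenDuhamel 1 s v v t x) →
      (∀ t < 0, Literature.Analysis.FluidPDE.VectorCalculus.IsDivFree (v t)) →
      (∀ s < 0, ∀ y, ⟪Literature.Analysis.FluidPDE.curl (v s) y, EuclideanSpace.single 2 1⟫_ℝ = 0) →
      ∀ W : Set (ℝ × EuclideanSpace ℝ (Fin 3)), IsOpen W → W.Nonempty → W ⊆ Set.Iio (0 : ℝ) ×ˢ Set.univ →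
        (∀ z ∈ W, Literature.Analysis.FluidPDE.curl (v z.1) z.2 ≠ 0 ∧
          (fderiv ℝ (v z.1) z.2 (EuclideanSpace.single 0 1) 2 ≠ 0 ∨ fderiv ℝ (v z.1) z.2 (EuclideanSpace.single 1 1) 2 ≠ 0) ∧
          (fderiv ℝ (v z.1) z.2 (EuclideanSpace.single 2 1) 0 ≠ 0 ∨ fderiv ℝ (v z.1) z.2 (EuclideanSpace.single 2 1) 1 ≠ 0)) →
        (∀ m : ℝ → ℝ, ∀ W₁ : Set (ℝ × EuclideanSpace ℝ (Fin 3)), W₁ ⊆ W → IsOpen W₁ → W₁.Nonempty →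
          ∃ z ∈ W₁, ∃ b : Fin 3, b ≠ 2 ∧
            fderiv ℝ (v z.1) z.2 (EuclideanSpace.single 2 1) b ≠
              m z.1 * fderiv ℝ (v z.1) z.2 (EuclideanSpace.single b 1) 2) →
        ¬ Literature.Analysis.FluidPDE.IsBackwardSingularPoint v 0 := by
  intro C v hrate hcont hmild hdiv hpol W hW hWne hWs hnd hpin
  set T : ℝ × EuclideanSpace ℝ (Fin 3) → ℝ := fun z =>
    fderiv ℝ (fun x => fderiv ℝ (v z.1) x (EuclideanSpace.single 2 1) 2) z.2 (EuclideanSpace.single 0 1) *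
              fderiv ℝ (v z.1) z.2 (EuclideanSpace.single 1 1) 2 -
            fderiv ℝ (fun x => fderiv ℝ (v z.1) x (EuclideanSpace.single 2 1) 2) z.2 (EuclideanSpace.single 1 1) *
              fderiv ℝ (v z.1) z.2 (EuclideanSpace.single 0 1) 2 with hT
  by_cases htw : ∃ z ∈ W, T z ≠ 0
  · obtain ⟨z₀, hz₀W, hz₀⟩ := htw
    have hslab : IsOpen (Set.Iio (0 : ℝ) ×ˢ (Set.univ : Set (EuclideanSpace ℝ (Fin 3)))) :=
      isOpen_Iio.prod isOpen_univ
    have hTc : ContinuousOn T (Set.Iio (0 : ℝ) ×ˢ Set.univ) := by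
      rw [hT]
      exact continuousOn_twist hrate hcont hmild
    have hO : IsOpen ((Set.Iio (0 : ℝ) ×ˢ Set.univ) ∩ T ⁻¹' {0}ᶜ) :=
      hTc.isOpen_inter_preimage hslab isOpen_compl_singleton
    set W₃ : Set (ℝ × EuclideanSpace ℝ (Fin 3)) := W ∩ ((Set.Iio (0 : ℝ) ×ˢ Set.univ) ∩ T ⁻¹' {0}ᶜ) with hW₃
    have hW₃o : IsOpen W₃ := hW.inter hO
    have hW₃W : W₃ ⊆ W := Set.inter_subset_left
    have hW₃ne : W₃.Nonempty := ⟨z₀, hz₀W, hWs hz₀W, hz₀⟩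
    refine twisting_of_rieszCollapse C v hrate hcont hmild hdiv hpol W₃ hW₃o hW₃ne (hW₃W.trans hWs)
      (fun z hz => hnd z (hW₃W hz)) (fun m W₁ hW₁ hW₁o hW₁ne => hpin m W₁ (hW₁.trans hW₃W) hW₁o hW₁ne) ?_
    intro z hz
    exact hz.2.2
  · push Not at htw
    exact Summit.NavierStokesRegularity.NavierStokesRegularity.Theorems.PoloidalWindowDoorPoloidalWindowRigidityStubUntwisted.stub_untwisted
      C v hrate hcont hmild hdiv hpol W hW hWne hWs hnd htw

/-- **LRC″ with spatial pins, UNDER THE SINGULARITY ASSUMPTION** (vacuously, from `ndRegular`) — the hypothesis `hLRC` of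
`…K2OfLrcSpatial.nonflatLiouville_of_lrc_spatial`. -/
theorem lrcSpatial_of_stubs :
    ∀ (C : ℝ) (v : ℝ → EuclideanSpace ℝ (Fin 3) → EuclideanSpace ℝ (Fin 3)),
      Literature.Analysis.FluidPDE.HasTypeITimeDecay C v →
      ContinuousOn (Function.uncurry v) (Set.Iio (0 : ℝ) ×ˢ Set.univ) →
      (∀ s t : ℝ, s < t → t < 0 → ∀ x, v t x =
        Literature.Analysis.UnboundedOperators.heatExtension (v s) (t - s) x -
          Literature.Analysis.FluidPDE.oseenDuhamel 1 s v v t x) →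
      (∀ t < 0, Literature.Analysis.FluidPDE.VectorCalculus.IsDivFree (v t)) →
      (∀ s < 0, ∀ y, ⟪Literature.Analysis.FluidPDE.curl (v s) y, EuclideanSpace.single 2 1⟫_ℝ = 0) →
      Literature.Analysis.FluidPDE.IsBackwardSingularPoint v 0 →
      ∀ W : Set (ℝ × EuclideanSpace ℝ (Fin 3)), IsOpen W → W.Nonempty → W ⊆ Set.Iio (0 : ℝ) ×ˢ Set.univ →
        (∀ z ∈ W, Literature.Analysis.FluidPDE.curl (v z.1) z.2 ≠ 0 ∧
          (fderiv ℝ (v z.1) z.2 (EuclideanSpace.single 0 1) 2 ≠ 0 ∨ fderiv ℝ (v z.1) z.2 (EuclideanSpace.single 1 1) 2 ≠ 0) ∧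
          (fderiv ℝ (v z.1) z.2 (EuclideanSpace.single 2 1) 0 ≠ 0 ∨ fderiv ℝ (v z.1) z.2 (EuclideanSpace.single 2 1) 1 ≠ 0)) →
        (∀ m : ℝ → ℝ, ∀ W₁ : Set (ℝ × EuclideanSpace ℝ (Fin 3)), W₁ ⊆ W → IsOpen W₁ → W₁.Nonempty →
          ∃ z ∈ W₁, ∃ b : Fin 3, b ≠ 2 ∧
            fderiv ℝ (v z.1) z.2 (EuclideanSpace.single 2 1) b ≠
              m z.1 * fderiv ℝ (v z.1) z.2 (EuclideanSpace.single b 1) 2) →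
        ∃ s : ℝ, s < 0 ∧ ∃ U : Set (EuclideanSpace ℝ (Fin 3)), IsOpen U ∧ U.Nonempty ∧
          ((∃ e : EuclideanSpace ℝ (Fin 3), e ≠ 0 ∧ ∀ y ∈ U, fderiv ℝ (Literature.Analysis.FluidPDE.curl (v s)) y e = 0) ∨
           (∃ c : EuclideanSpace ℝ (Fin 3), ∀ y ∈ U,
              Literature.Analysis.FluidPDE.rotGen (Literature.Analysis.FluidPDE.curl (v s) y) =
                fderiv ℝ (Literature.Analysis.FluidPDE.curl (v s)) y (Literature.Analysis.FluidPDE.rotGen (y - c)))) := by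
  intro C v hrate hcont hmild hdiv hpol hsing W hW hWne hWs hnd hpin
  exact absurd hsing (ndRegular C v hrate hcont hmild hdiv hpol W hW hWne hWs hnd hpin)

/-- **(TV) — both halves are tree theorems** (`…TimeShearLiminf.stub_tvLiminf`, p525351, and
`…HorizontalFlatPast.nonflatLiouville_of_timeShear_unbounded`): the hypothesis `hTV` of
`…K2OfLrcSpatial.nonflatLiouville_of_lrc_spatial`. -/
theorem tv_of_stubs :
    ∀ (C : ℝ) (v : ℝ → EuclideanSpace ℝ (Fin 3) → EuclideanSpace ℝ (Fin 3)),
      Literature.Analysis.FluidPDE.HasTypeITimeDecay C v →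
      ContinuousOn (Function.uncurry v) (Set.Iio (0 : ℝ) ×ˢ Set.univ) →
      (∀ s t : ℝ, s < t → t < 0 → ∀ x, v t x =
        Literature.Analysis.UnboundedOperators.heatExtension (v s) (t - s) x -
          Literature.Analysis.FluidPDE.oseenDuhamel 1 s v v t x) →
      (∀ t < 0, Literature.Analysis.FluidPDE.VectorCalculus.IsDivFree (v t)) →
      (∀ s < 0, ∀ y, ⟪Literature.Analysis.FluidPDE.curl (v s) y, EuclideanSpace.single 2 1⟫_ℝ = 0) →
      ∀ μ : ℝ → ℝ, (∀ s < 0, μ s < 0) → (∀ s < 0, AnalyticAt ℝ μ s) →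
        (∃ s₁ s₂ : ℝ, s₁ < 0 ∧ s₂ < 0 ∧ μ s₁ ≠ μ s₂) →
        (∀ s < 0, ∀ y, ∀ b : Fin 3, b ≠ 2 →
          fderiv ℝ (v s) y (EuclideanSpace.single 2 1) b = μ s * fderiv ℝ (v s) y (EuclideanSpace.single b 1) 2) →
        ¬ Literature.Analysis.FluidPDE.IsBackwardSingularPoint v 0 := by
  intro C v hrate hcont hmild hdiv hpol μ hneg han hnc hslope
  by_cases hB : ∃ M : ℝ, ∀ T : ℝ, ∃ τ < T, -M ≤ μ τ
  · exact Summit.NavierStokesRegularity.NavierStokesRegularity.Theorems.PoloidalWindowDoorPoloidalWindowRigidityTimeShearLiminf.stub_tvLiminf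
      C v hrate hcont hmild hdiv hpol μ hneg han hnc hslope hB
  · push Not at hB
    refine nonflatLiouville_of_timeShear_unbounded hrate hcont hmild hdiv hpol hslope fun M => ?_
    obtain ⟨T, hT⟩ := hB M
    refine ⟨T, fun τ hτ => ?_⟩
    have h1 : μ τ < -M := hT τ hτ
    have h2 : M < -μ τ := by linarith
    exact h2.le.trans (neg_le_abs (μ τ))

/-- **The slice-sharp residue from the stubs** (symmetry/genericity hypotheses unused): class + poloidal ⇒ not backward-singular,
by contradiction through `…K2OfLrcSpatial.nonflatLiouville_of_lrc_spatial`. -/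
theorem sliceSharpNonflatLiouville_of_rieszCollapse :
    ∀ (C : ℝ) (v : ℝ → EuclideanSpace ℝ (Fin 3) → EuclideanSpace ℝ (Fin 3)),
      Literature.Analysis.FluidPDE.HasTypeITimeDecay C v →
      ContinuousOn (Function.uncurry v) (Set.Iio (0 : ℝ) ×ˢ Set.univ) →
      (∀ s t : ℝ, s < t → t < 0 → ∀ x, v t x =
        Literature.Analysis.UnboundedOperators.heatExtension (v s) (t - s) x -
          Literature.Analysis.FluidPDE.oseenDuhamel 1 s v v t x) →
      (∀ t < 0, Literature.Analysis.FluidPDE.VectorCalculus.IsDivFree (v t)) →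
      (∀ s < 0, ∀ y, ⟪Literature.Analysis.FluidPDE.curl (v s) y, EuclideanSpace.single 2 1⟫_ℝ = 0) →
      (∀ s < 0, ∀ y, ⟪fderiv ℝ (v s) y (Literature.Analysis.FluidPDE.curl (v s) y), EuclideanSpace.single 2 1⟫_ℝ = 0) →
      (∀ s < 0, ∀ b : EuclideanSpace ℝ (Fin 3), b ≠ 0 → ∃ y,
        Literature.Analysis.FluidPDE.cross (Literature.Analysis.FluidPDE.curl (v s) y) b ≠ 0) →
      (∀ s < 0, ∃ y, fderiv ℝ (v s) y (EuclideanSpace.single 2 1) 0 ≠ 0 ∨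
        fderiv ℝ (v s) y (EuclideanSpace.single 2 1) 1 ≠ 0) →
      (∀ s < 0, ∀ a : EuclideanSpace ℝ (Fin 3), a ≠ 0 → ⟪a, EuclideanSpace.single 2 1⟫_ℝ = 0 →
        ∃ y, ⟪fderiv ℝ (v s) y a, EuclideanSpace.single 2 1⟫_ℝ ≠ 0) →
      (∀ s < 0, ∀ e : EuclideanSpace ℝ (Fin 3), e ≠ 0 → ∃ (y : EuclideanSpace ℝ (Fin 3)) (l : ℝ), v s (y + l • e) ≠ v s y) →
      (∀ s < 0, ∀ (L : EuclideanSpace ℝ (Fin 3) ≃ₗᵢ[ℝ] EuclideanSpace ℝ (Fin 3)) (c : EuclideanSpace ℝ (Fin 3)),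
        ¬ Literature.Analysis.FluidPDE.IsAxisymmetric (fun y => L.symm (v s (L y + c)))) →
      (∃ lam : ℝ, 0 < lam ∧ ∃ s < 0, ∃ y, lam • v (lam ^ 2 * s) (lam • y) ≠ v s y) →
        ¬ Literature.Analysis.FluidPDE.IsBackwardSingularPoint v 0 := by
  intro C v hrate hcont hmild hdiv hpol _ _ _ _ _ _ _ hsing
  exact nonflatLiouville_of_lrc_spatial hrate hcont hmild hdiv hpol
    (lrcSpatial_of_stubs C v hrate hcont hmild hdiv hpol hsing) (tv_of_stubs C v hrate hcont hmild hdiv hpol) hsing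

/-- **COMPOSITION (proved): the crux `PoloidalWindowRigidity` BY NAME** from this line's ONE own stub `stub_rieszCollapse` (R1, provable:
semi-elliptic slices are rigid) — the SEMI-ELLIPTIC THICK column — and the shared stubs `stub_hyperbolicTH` ((TH) column:
string_shells / entire_slices) and `stub_hyperbolicThick` (hyperbolic thick column: z_shock / mixed_type), via the landed reduction
`…Sharper.poloidalWindowRigidity_of_sliceSharpNonflatLiouville`.  No summit is proved: three `sorry`s, all inside `stub_*` (two of them the SHARED hyperbolic columns). -/
theorem PoloidalWindowRigidity_of_rieszCollapse :
    Summit.NavierStokesRegularity.NavierStokesRegularity.Theses.PoloidalWindowDoor.PoloidalWindowRigidity :=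
  poloidalWindowRigidity_of_sliceSharpNonflatLiouville sliceSharpNonflatLiouville_of_rieszCollapse

end Summit.NavierStokesRegularity.NavierStokesRegularity.Cruxes.PoloidalWindowRigidity.RieszCollapse
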